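import Literature.NumberTheory.EllipticCurves.SubgroupSelmer
import Literature.NumberTheory.EllipticCurves.SelmerGaloisAction
import Literature.NumberTheory.GaloisRepresentations.ContinuousH1
import Mathlib.NumberTheory.NumberField.InfinitePlace.TotallyRealComplex
import HarnessLib

/-!
# The local condition of `Sel_{p^∞}(E/L)` at a COMPLEX place is vacuous (proofs file)

Topic `NumberTheory/EllipticCurves` (cell `pub/bsd-print-x9`, blueprint HOME/p2/S1-DISCRETE-CONTROL §2 «v archimedean»;
companion of `SubgroupSelmer` (`WeierstrassCurve.localKerOver`) and `SelmerGaloisAction` (`Γ_E = 1` for `E`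
algebraically closed)). THEOREMS ONLY; no definition, no named fact, no instance, no `sorry`.

For a number field `K`, a subgroup `H ≤ Γ_K` (e.g. `Gal(K̄/K_∞)`), a Weierstrass curve `W/K`, a prime `p` and an
infinite place `w`:

* `WeierstrassCurve.localKerOver_completion_eq_top_of_isComplex` — if `w` is complex then
  `W.localKerOver p H w.Completion = ⊤`: `K_w ≃ ℂ` is algebraically closed, `Γ_{K_w} = 1`, so the local group
  `H_{K_w} ≤ Γ_{K_w}` is trivial and `H¹(H_{K_w}, E(K̄_w)) = 0`;
* `WeierstrassCurve.mem_localKerOver_completion_of_isTotallyComplex` — for `K` totally complex (e.g. imaginary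
  quadratic) EVERY class satisfies the local condition of `Sel_{p^∞}(E/K̄^H)` at EVERY infinite place.

This is the archimedean clause of the Selmer conditions on the readout of `H¹_F(K, A_𝔮)` ((B4) of the discrete half of
the shared μ-crux's `stub_controlGlue`; Howard's `K` is imaginary quadratic).  BSD is not proved by any of this.

References: [GreenbergLNM1716] §3 p. 87 (archimedean primes split completely; no condition for `p` odd);
[SerreGaloisCohomology1997] I §2.2.
-/

noncomputable section

open scoped Classical

open NumberField Field Literature.NumberTheory.EllipticCurves Literature.NumberTheory.GaloisRepresentations

universe u

namespace WeierstrassCurve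

variable {K : Type u} [Field K] (W : WeierstrassCurve K) (p : ℕ) (H : Subgroup (absoluteGaloisGroup K))

/-- Over a field `E ⊇ K` with TRIVIAL absolute Galois group (e.g. `E` algebraically closed) the local kernel at `E`
over `K̄^H` is everything: `H¹(H_E, E(K̄_E)) = 0` since `H_E ≤ Γ_E = 1`. [cite: SerreGaloisCohomology1997, I §2.2] -/
theorem localKerOver_eq_top_of_subsingleton {E : Type u} [Field E] [Algebra K E]
    [Subsingleton (absoluteGaloisGroup E)] : W.localKerOver p H E = ⊤ := by
  rw [eq_top_iff]
  intro c _
  rw [mem_localKerOver_iff]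
  obtain ⟨φ, hφ⟩ := oneCocycleClass_surjective _ (W.localResOver p H E c)
  rw [← hφ, oneCocycleClass_eq_zero_iff]
  refine ⟨0, fun g ↦ ?_⟩
  rw [Subsingleton.elim g 1, contOneCocycles.apply_one, map_zero, sub_zero]

/-- **At a complex place the local condition of `Sel_{p^∞}(E/K̄^H)` is vacuous**: `K_w ≃ ℂ` is algebraically closed, so
`Γ_{K_w} = 1` and `W.localKerOver p H K_w = ⊤`. [cite: GreenbergLNM1716, §3 p. 87 (archimedean primes split completely)] -/
theorem localKerOver_completion_eq_top_of_isComplex [NumberField K] {w : InfinitePlace K} (hw : w.IsComplex) :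
    W.localKerOver p H w.Completion = ⊤ := by
  haveI : IsAlgClosed w.Completion :=
    isAlgClosed_of_ringEquiv (InfinitePlace.Completion.ringEquivComplexOfIsComplex hw).symm
  haveI := subsingleton_absoluteGaloisGroup_of_isAlgClosed w.Completion
  exact W.localKerOver_eq_top_of_subsingleton p H

/-- **For a totally complex `K` every class satisfies the archimedean conditions of `Sel_{p^∞}(E/K̄^H)`** (all
infinite places are complex). [cite: GreenbergLNM1716, §3 p. 87] -/
theorem mem_localKerOver_completion_of_isTotallyComplex [NumberField K] [IsTotallyComplex K] (w : InfinitePlace K)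
    (c : W.subgroupH1 p H) : c ∈ W.localKerOver p H w.Completion := by
  rw [W.localKerOver_completion_eq_top_of_isComplex p H (IsTotallyComplex.isComplex w)]
  trivial

end WeierstrassCurve
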